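import Mathlib.LinearAlgebra.Trace
import Mathlib.LinearAlgebra.Matrix.StdBasis
import Mathlib.RepresentationTheory.Invariants
import Literature.RepresentationTheory.FiniteGroups.WedderburnBlocks
import HarnessLib

/-!
# Fourier inversion at the identity for `ℂ[G] ≃ ∏ᵢ ℂ^{dᵢ×dᵢ}` and the trivial block

Topic `Literature/RepresentationTheory/FiniteGroups`. For a finite group `G` and ANY algebra
isomorphism `φ : ℂ[G] ≃ₐ[ℂ] ∏ᵢ ℂ^{dᵢ×dᵢ}` (Wedderburn; the tree's `exists_algEquiv_pi_matrix`,
`WedderburnBlocks.lean`) we PROVE: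

* `card_mul_coeff_one_eq_sum_trace` — **Fourier inversion at `1`**:
  `|G| · x(1) = ∑ᵢ dᵢ · tr (φ x)ᵢ` for every `x ∈ ℂ[G]` (Serre 1977, §6.2, Prop. 11, the
  "Fourier inversion formula" `u(s) = (1/g) ∑ᵢ nᵢ Tr_{Wᵢ}(ρᵢ(s⁻¹) uᵢ)`, at `s = 1`; equivalently the
  case `v = 1` of the formula of Serre's Exercise 6.2; it is the identity
  "`|G||S||T||U| = ∑_π d_π Tr(…)`" of Blasiak–Cohn–Grochow–Pratt–Umans 2023, proof of Thm. 3.2,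
  and holds for any algebra isomorphism `φ`, a proved generalisation of Serre's `ρ̃`). Proof: both
  sides are the trace of left multiplication by `x` — on `ℂ[G]` in the basis `G` it is `|G| x(1)`
  (`trace_mulLeft_monoidAlgebra`), on `∏ᵢ ℂ^{dᵢ×dᵢ}` in Mathlib's matrix-unit basis
  `Pi.basis fun i => Matrix.stdBasis ℂ _ _` it is `∑ᵢ dᵢ tr Bᵢ` (`trace_mulLeft_blockAlgebra`), and
  `φ` conjugates one into the other.
* `exists_trivial_block` — some block is the **trivial representation**: there is `i₀` with
  `d_{i₀} = 1` and `(φ g)_{i₀} = 1` for all `g ∈ G` (the image of `e = ∑_g g` is non-zero in some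
  block; a non-zero column of it is a `G`-fixed vector, and by irreducibility of the block
  representation (`isIrreducible_blockRep`) every vector is then fixed and the block is a line).

These are the two ingredients of the non-abelian Fourier analysis intended for the proof of the
named fact `QuasirandomBarrier` (BCGPU 2023, Thm. 3.2;
`Literature/Barriers/MatrixMultiplication/QuasirandomBarrier.lean`).

## References

* J.-P. Serre, *Linear Representations of Finite Groups*, GTM 42, Springer 1977, §6.2
  (Prop. 10, Prop. 11 "Fourier inversion formula", Ex. 6.2), §2.4 Prop. 5 and Cor. 1–2 (held:
  `book:serre1977-linear-representations-finite-groups`, pp. 21, 44 of the text). [Serre1977]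
* J. Blasiak, H. Cohn, J. A. Grochow, K. Pratt, C. Umans, *Matrix multiplication via matrix
  groups*, ITCS 2023, arXiv:2204.03826, proof of Thm. 3.2. [BlasiakCohnGrochowPrattUmans2023]
-/

noncomputable section

open scoped BigOperators
open Module

namespace Literature.RepresentationTheory.FiniteGroups

variable {G : Type} [Group G]
variable {r : ℕ} {d : Fin r → ℕ}

/-! ## Traces of left multiplications -/

/-- **Trace of left multiplication on `∏ᵢ ℂ^{dᵢ×dᵢ}`**: `Tr (B · ) = ∑ᵢ dᵢ tr Bᵢ` (each block
`ℂ^{dᵢ×dᵢ}` is, as a left module over itself, `dᵢ` copies of the column space), computed in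
Mathlib's matrix-unit basis `Pi.basis fun i => Matrix.stdBasis ℂ (Fin dᵢ) (Fin dᵢ)`. [folklore] -/
theorem trace_mulLeft_blockAlgebra (B : BlockAlgebraC d) :
    LinearMap.trace ℂ (BlockAlgebraC d) (LinearMap.mulLeft ℂ B) =
      ∑ i, (d i : ℂ) * Matrix.trace (B i) := by
  classical
  set b : Basis (Σ i : Fin r, Fin (d i) × Fin (d i)) ℂ (BlockAlgebraC d) :=
    Pi.basis fun i : Fin r => Matrix.stdBasis ℂ (Fin (d i)) (Fin (d i)) with hb
  rw [LinearMap.trace_eq_matrix_trace ℂ b, Matrix.trace]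
  simp only [Matrix.diag, LinearMap.toMatrix_apply, LinearMap.mulLeft_apply]
  have hrepr : ∀ (y : BlockAlgebraC d) (x : Σ i : Fin r, Fin (d i) × Fin (d i)),
      b.repr y x = y x.1 x.2.1 x.2.2 := fun y x => by
    rw [hb, Pi.basis_repr]
    simp [Matrix.stdBasis]
  have happly : ∀ x : Σ i : Fin r, Fin (d i) × Fin (d i),
      b x = Pi.single x.1 (Matrix.single x.2.1 x.2.2 1) := fun x => by
    rw [hb, Pi.basis_apply, Matrix.stdBasis_eq_single]
  simp_rw [hrepr, happly]
  rw [Fintype.sum_sigma]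
  refine Finset.sum_congr rfl fun i _ => ?_
  rw [Fintype.sum_prod_type]
  simp only [Pi.mul_apply, Pi.single_eq_same, Matrix.mul_apply, Matrix.single_apply, mul_ite,
    mul_one, mul_zero]
  simp only [and_true, Finset.sum_ite_eq, Finset.mem_univ, if_true, Finset.sum_const,
    Finset.card_univ, Fintype.card_fin, nsmul_eq_mul, Matrix.trace, Matrix.diag, Finset.mul_sum]

/-- **Trace of left multiplication on `ℂ[G]`**: `Tr (x · ) = |G| · x(1)` (left multiplication by
`g ≠ 1` permutes the basis `G` without fixed points; this is the character of the regular
representation, Serre 1977, §2.4 Prop. 5). [cite: Serre1977, §2.4 Prop. 5] -/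
theorem trace_mulLeft_monoidAlgebra [Fintype G] (x : MonoidAlgebra ℂ G) :
    LinearMap.trace ℂ (MonoidAlgebra ℂ G) (LinearMap.mulLeft ℂ x) =
      (Fintype.card G : ℂ) * x.coeff 1 := by
  classical
  rw [LinearMap.trace_eq_matrix_trace ℂ (MonoidAlgebra.basis G ℂ), Matrix.trace]
  simp only [Matrix.diag, LinearMap.toMatrix_apply, LinearMap.mulLeft_apply,
    MonoidAlgebra.basis_apply]
  have h : ∀ g : G, (MonoidAlgebra.basis G ℂ).repr (x * MonoidAlgebra.single g 1) g =
      x.coeff 1 := fun g => by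
    change (x * MonoidAlgebra.single g 1).coeff g = x.coeff 1
    rw [MonoidAlgebra.coeff_mul_single_apply, mul_inv_cancel, mul_one]
  simp_rw [h, Finset.sum_const, Finset.card_univ, nsmul_eq_mul]

/-- **Fourier inversion at the identity for `ℂ[G] ≃ ∏ᵢ ℂ^{dᵢ×dᵢ}`**: for every algebra
isomorphism `φ` and every `x ∈ ℂ[G]`, `|G| · x(1) = ∑ᵢ dᵢ · tr (φ x)ᵢ` (Serre 1977, §6.2,
Prop. 11, "Fourier inversion formula", at `s = 1`; equivalently Serre's Ex. 6.2 with `v = 1`;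
the identity behind "`|G||S||T||U| = ∑_π d_π Tr(…)`" in BCGPU 2023, proof of Thm. 3.2). Both
sides are the trace of left multiplication by `x`, transported by `φ`.
[cite: Serre1977, §6.2 Prop. 11] -/
theorem card_mul_coeff_one_eq_sum_trace [Fintype G] (φ : MonoidAlgebra ℂ G ≃ₐ[ℂ] BlockAlgebraC d)
    (x : MonoidAlgebra ℂ G) :
    (Fintype.card G : ℂ) * x.coeff 1 = ∑ i, (d i : ℂ) * Matrix.trace (φ x i) := by
  rw [← trace_mulLeft_monoidAlgebra, ← trace_mulLeft_blockAlgebra,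
    ← LinearMap.trace_conj' _ φ.toLinearEquiv]
  congr 1
  refine LinearMap.ext fun B => ?_
  simp [LinearEquiv.conj_apply, map_mul]

/-- The regular character decomposes as `∑ᵢ dᵢ χᵢ`: `∑ᵢ dᵢ tr (φ g)ᵢ = |G| [g = 1]`
(Serre 1977, §2.4 Cor. 1–2). [cite: Serre1977, §2.4 Cor. 2] -/
theorem sum_blockDegree_mul_trace_single [Fintype G] [DecidableEq G]
    (φ : MonoidAlgebra ℂ G ≃ₐ[ℂ] BlockAlgebraC d) (g : G) :
    ∑ i, (d i : ℂ) * Matrix.trace (φ (MonoidAlgebra.single g 1) i) =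
      if g = 1 then (Fintype.card G : ℂ) else 0 := by
  rw [← card_mul_coeff_one_eq_sum_trace, MonoidAlgebra.coeff_single, Finsupp.single_apply]
  split_ifs <;> simp

/-! ## The trivial block -/

/-- `e = ∑_g g ∈ ℂ[G]` is absorbed by left translations: `h · e = e`. [folklore] -/
theorem single_mul_sum_single [Fintype G] (h : G) :
    MonoidAlgebra.single h (1 : ℂ) * ∑ g, MonoidAlgebra.single g 1 =
      ∑ g, MonoidAlgebra.single g (1 : ℂ) := by
  simp only [Finset.mul_sum, MonoidAlgebra.single_mul_single, one_mul]
  exact Fintype.sum_equiv (Equiv.mulLeft h) _ _ fun g => rfl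

/-- **Some Wedderburn block is the trivial representation**: there is `i₀` with `d_{i₀} = 1` and
`(φ g)_{i₀} = 1` for every `g ∈ G` (Serre 1977, §2.4 Cor. 1: every irreducible representation —
here the unit representation — "is contained in the regular representation"; concretely, the image
of `e = ∑_g g` is non-zero in some block `i₀`, a non-zero column of it is fixed by `G`, and the
block representation being irreducible (`isIrreducible_blockRep`) all of `ℂ^{d_{i₀}}` is fixed
and is a line). [cite: Serre1977, §2.4 Cor. 1] -/
theorem exists_trivial_block [Finite G] [∀ i, NeZero (d i)]
    (φ : MonoidAlgebra ℂ G ≃ₐ[ℂ] BlockAlgebraC d) :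
    ∃ i₀ : Fin r, d i₀ = 1 ∧ ∀ g : G, φ (MonoidAlgebra.single g 1) i₀ = 1 := by
  classical
  haveI : Fintype G := Fintype.ofFinite G
  set e : MonoidAlgebra ℂ G := ∑ g, MonoidAlgebra.single g 1 with he
  have he0 : e ≠ 0 := by
    intro h0
    have h1 := congrArg (fun x : MonoidAlgebra ℂ G => x.coeff 1) h0
    simp only [he, MonoidAlgebra.coeff_sum, MonoidAlgebra.coeff_single, Finset.sum_apply',
      Finsupp.single_apply, Finset.sum_ite_eq', Finset.mem_univ, if_true,
      MonoidAlgebra.coeff_zero, Finsupp.coe_zero, Pi.zero_apply] at h1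
    exact one_ne_zero h1
  have hφe : φ e ≠ 0 := fun h0 => he0 (by simpa using h0)
  obtain ⟨i₀, hi₀⟩ : ∃ i, φ e i ≠ 0 := by
    by_contra hall
    push Not at hall
    exact hφe (funext hall)
  obtain ⟨a, b, hab⟩ : ∃ a b, φ e i₀ a b ≠ 0 := by
    by_contra hall
    push Not at hall
    exact hi₀ (Matrix.ext fun a b => hall a b)
  -- the column `b` of `(φ e)_{i₀}` is a non-zero fixed vector
  set v : Fin (d i₀) → ℂ := fun k => φ e i₀ k b with hv
  have hva : v a ≠ 0 := hab
  have hfix : ∀ h : G, Matrix.toLin' (φ (MonoidAlgebra.single h 1) i₀) v = v := by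
    intro h
    have hmul : φ (MonoidAlgebra.single h 1) i₀ * φ e i₀ = φ e i₀ := by
      rw [← Pi.mul_apply, ← map_mul, single_mul_sum_single]
    funext k
    have hk := congrArg (fun M : Matrix (Fin (d i₀)) (Fin (d i₀)) ℂ => M k b) hmul
    simp only [Matrix.mul_apply] at hk
    simpa [Matrix.toLin'_apply, Matrix.mulVec, dotProduct, hv] using hk
  -- the fixed vectors form a subrepresentation of the (irreducible) block representation
  set ρ := blockRep φ i₀ with hρ
  let W : Subrepresentation ρ := ⟨ρ.invariants, fun h w hw => by
    rw [Representation.mem_invariants] at hw ⊢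
    intro g
    rw [hw h, hw g]⟩
  have hvW : v ∈ W.toSubmodule := by
    change v ∈ ρ.invariants
    rw [Representation.mem_invariants]
    intro h
    rw [hρ, blockRep_apply]
    exact hfix h
  -- hence every vector is fixed
  have hall : ∀ (w : Fin (d i₀) → ℂ) (h : G),
      Matrix.toLin' (φ (MonoidAlgebra.single h 1) i₀) w = w := by
    intro w h
    let L : (Fin (d i₀) → ℂ) →ₗ[ℂ] (Fin (d i₀) → ℂ) := (LinearMap.proj a).smulRight ((v a)⁻¹ • w)
    have hL : L v = w := by
      simp only [L, LinearMap.smulRight_apply, LinearMap.proj_apply, smul_smul,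
        mul_inv_cancel₀ hva, one_smul]
    have hw : w ∈ W.toSubmodule := by
      have := toLin'_apply_mem_of_blockRep φ i₀ W hvW (LinearMap.toMatrix' L)
      rwa [Matrix.toLin'_toMatrix', hL] at this
    change w ∈ ρ.invariants at hw
    rw [Representation.mem_invariants] at hw
    have := hw h
    rwa [hρ, blockRep_apply] at this
  have hone : ∀ h : G, φ (MonoidAlgebra.single h 1) i₀ = 1 := by
    intro h
    apply Matrix.toLin'.injective
    rw [Matrix.toLin'_one]
    exact LinearMap.ext fun w => hall w h
  refine ⟨i₀, ?_, hone⟩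
  -- the block is a line: the span of `v` is invariant, hence everything
  have hirr := isIrreducible_blockRep φ i₀
  let Lv : Subrepresentation ρ := ⟨ℂ ∙ v, fun h w hw => by
    rw [hρ, blockRep_apply, hall w h]
    exact hw⟩
  have hLv : Lv ≠ ⊥ := by
    intro hbot
    have hmem : v ∈ (⊥ : Subrepresentation ρ).toSubmodule :=
      hbot ▸ Submodule.mem_span_singleton_self v
    change v ∈ (⊥ : Submodule ℂ (Fin (d i₀) → ℂ)) at hmem
    rw [Submodule.mem_bot] at hmem
    exact hva (by rw [hmem]; rfl)
  have htop : Lv = ⊤ := (hirr.eq_bot_or_eq_top Lv).resolve_left hLv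
  have hspan : (ℂ ∙ v) = ⊤ := by
    have := congrArg Subrepresentation.toSubmodule htop
    exact this
  have hv0 : v ≠ 0 := fun h0 => hva (by rw [h0]; rfl)
  have h1 : finrank ℂ (Fin (d i₀) → ℂ) = 1 := by
    rw [← finrank_top, ← hspan, finrank_span_singleton hv0]
  simpa using h1

end Literature.RepresentationTheory.FiniteGroups

end
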